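/-
Copyright: cell `pub-balaban-gaps` (G2), seat ne6 (row NE7b), `prover-pub-balaban-gaps-ne6-g20-0`. Project licence.
-/
import Summits.QuantumFields.BalabanUV.T4Continuum.Spine.NE7b.CompactFibreMeanActionSUNDeriv
import Summits.QuantumFields.BalabanUV.T4Continuum.Spine.NE7b.CompactFibreCharacterNormSUN
import Mathlib.Analysis.Calculus.LHopital

/-!
# THE STRONG-COUPLING EXPANSION OF THE ONE-PLAQUETTE FREE ENERGY TO SECOND ORDER, EVERY `N`:
# `−log Z_N(β) = N·β − ½·Var₀·β² + o(β²)`, `Var₀ = ∫(Re tr(1−V) − N)² dHaar = ½ (N ≥ 3), 1 (N = 2)` (row NE7b, node U5c; MODEL, [folklore]; census V58)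

Cell `pub-balaban-gaps` (G2 spine census) for the `pub-balaban` T⁴ crux NE7b (`T4WeightBudget.RelWeightBound`; NOT PRINTED, NOT PROVED).  Crux-route work under
`Spine/NE7b/`; imports the landed V56 `CompactFibreMeanActionSUNDeriv` (`hasDerivAt_meanAction_SUN`; it re-exports V50's `hasDerivAt_freeEnergy_SUN`, `meanAction_zero`
and V46's `continuous_re_trace_one_sub`, `integral_re_trace_one_sub_haar_SUN`) and V51 `CompactFibreCharacterNormSUN` (`integral_sq_traceDeficit_sub_mean` = `½` for
`N ≥ 3`, `integral_sq_traceDeficit_sub_mean_SU2` = `1`) + Mathlib (l'Hôpital `HasDerivAt.lhopital_zero_nhdsNE`, `HasDerivAt.tendsto_slope_zero`); no `def`, zero `sorry`,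
nothing of Bałaban's asserted.

THE LOCATED QUESTION.  This lineage's asymptotics are all at WEAK coupling (`β → ∞`: V45∕J3∕V54∕V55∕J5).  At STRONG coupling the tree has V46's tangent `−log Z_N(β) ≤ Nβ`
(strict off `β = 0` by V57) and the reference variance `∫(s − N)² dHaar` (V51: `½` for `N ≥ 3`, `1` for `SU(2)`).  QUESTION (V58): the free energy's SECOND-ORDER germ at
`β = 0`, every `N`.  ANSWER ([folklore], `s = Re tr(1−V)`, one `SU(N)` plaquette under Haar, `N ≥ 2`):
* §1 **`plaquetteMass_SUN_zero`** (`Z_N(0) = 1`), **`secondMoment_SUN_zero`** (`W(0) = ∫ s² dHaar`), **`integral_sq_sub_eq`** (`∫(s − N)² dHaar = ∫ s² dHaar − N²`),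
  **`actionVariance_SUN_zero`**: `W(0)∕Z(0) − (M(0)∕Z(0))² = ∫(s − N)² dHaar` — the tilted variance at `β = 0` is the reference variance;
* §2 **`tendsto_meanAction_sub_div`**: `(⟨s⟩_β − N)∕β → −∫(s − N)² dHaar` as `β → 0`, `β ≠ 0` (V56's derivative at `0` as a slope);
* §3 **`tendsto_freeEnergy_sub_linear_div_sq`**: `(−log Z_N(β) − Nβ)∕β² → −½·∫(s − N)² dHaar` as `β → 0`, `β ≠ 0` (l'Hôpital once, then §2) — i.e.
  `−log Z_N(β) = Nβ − ½·Var₀·β² + o(β²)`; **`tendsto_freeEnergy_sub_linear_div_sq_of_three_le`** (`N ≥ 3`: limit `−1∕4`) and **`tendsto_freeEnergy_sub_linear_div_sq_SU2`**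
  (limit `−1∕2`): the strong-coupling curvature is `N`-INDEPENDENT from `N = 3` on.

HONEST REMARKS.  (i) MODEL ∕ [folklore]: Haar calculus of ONE `SU(N)` plaquette variable — NOT the interacting measure, and NOT a cluster∕high-temperature expansion of the
lattice theory (one plaquette has no volume).  (ii) No remainder bound beyond `o(β²)`.  (iii) (A3) ∕ (A1c) NOT asserted; NC-NE7b-α UNRULED.  BY-NAME EFFECT ON THE WALL: NONE.
NE7b NOT PRINTED ∕ NOT PROVED; spine PROVED 0∕9; rung (B)+1 on ONE finite T⁴ — NOT infinite volume, NOT the mass gap, NOT Clay.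
HONEST DEPENDENCY: continuum YM on T⁴ ⇐ BetaPertH ∧ nine spine estimates (0/9 proved); BetaPertH ⇐ (D1) ∧ (D4) ∧ CAP+tail;
G-an2-4 gates asym, D1 and NE2/3/4.  This file changes none of it.
-/

set_option autoImplicit false

noncomputable section

open Real Set MeasureTheory Filter Topology
open Literature.MathematicalPhysics.QuantumFieldTheory (haarProbability)
open Summit.QuantumFields.BalabanUV.T4Continuum.NE7b.CompactFibrePlaquetteMassSUNTangentFloor (continuous_re_trace_one_sub integral_re_trace_one_sub_haar_SUN)
open Summit.QuantumFields.BalabanUV.T4Continuum.NE7b.CompactFibreMeanActionSUNMonotone (hasDerivAt_freeEnergy_SUN meanAction_zero)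
open Summit.QuantumFields.BalabanUV.T4Continuum.NE7b.CompactFibreMeanActionSUNDeriv (hasDerivAt_meanAction_SUN)
open Summit.QuantumFields.BalabanUV.T4Continuum.NE7b.CompactFibreCharacterNormSUN (integral_sq_traceDeficit_sub_mean integral_sq_traceDeficit_sub_mean_SU2)

namespace Summit.QuantumFields.BalabanUV.T4Continuum.NE7b.CompactFibreFreeEnergySUNStrongCoupling

variable {N : ℕ}

/-! ### §1 The moments at `β = 0` -/

/-- `Z_N(0) = 1`. [folklore] -/
theorem plaquetteMass_SUN_zero :
    (∫ V, Real.exp (-((0 : ℝ) * (Matrix.trace (1 - (V : Matrix (Fin N) (Fin N) ℂ))).re)) ∂(haarProbability (Matrix.specialUnitaryGroup (Fin N) ℂ))) = 1 := by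
  simp only [zero_mul, neg_zero, Real.exp_zero, integral_const, probReal_univ, one_smul]

/-- `W(0) = ∫ (Re tr(1−V))² dHaar`. [folklore] -/
theorem secondMoment_SUN_zero :
    (∫ V, (Matrix.trace (1 - (V : Matrix (Fin N) (Fin N) ℂ))).re ^ 2 * Real.exp (-((0 : ℝ) * (Matrix.trace (1 - (V : Matrix (Fin N) (Fin N) ℂ))).re))
        ∂(haarProbability (Matrix.specialUnitaryGroup (Fin N) ℂ)))
      = ∫ V, (Matrix.trace (1 - (V : Matrix (Fin N) (Fin N) ℂ))).re ^ 2 ∂(haarProbability (Matrix.specialUnitaryGroup (Fin N) ℂ)) := by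
  simp only [zero_mul, neg_zero, Real.exp_zero, mul_one]

/-- `∫ (Re tr(1−V) − N)² dHaar = ∫ (Re tr(1−V))² dHaar − N²` (`N ≥ 2`; V46's `∫ Re tr(1−V) dHaar = N`). [folklore] -/
theorem integral_sq_sub_eq (hN : 2 ≤ N) :
    ∫ V, ((Matrix.trace (1 - (V : Matrix (Fin N) (Fin N) ℂ))).re - (N : ℝ)) ^ 2 ∂(haarProbability (Matrix.specialUnitaryGroup (Fin N) ℂ))
      = (∫ V, (Matrix.trace (1 - (V : Matrix (Fin N) (Fin N) ℂ))).re ^ 2 ∂(haarProbability (Matrix.specialUnitaryGroup (Fin N) ℂ))) - (N : ℝ) ^ 2 := by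
  have hs := continuous_re_trace_one_sub (N := N)
  have hi1 : Integrable (fun V : Matrix.specialUnitaryGroup (Fin N) ℂ => (Matrix.trace (1 - (V : Matrix (Fin N) (Fin N) ℂ))).re)
      (haarProbability (Matrix.specialUnitaryGroup (Fin N) ℂ)) := hs.integrable_of_hasCompactSupport (HasCompactSupport.of_compactSpace _)
  have hi2 : Integrable (fun V : Matrix.specialUnitaryGroup (Fin N) ℂ => (Matrix.trace (1 - (V : Matrix (Fin N) (Fin N) ℂ))).re ^ 2)
      (haarProbability (Matrix.specialUnitaryGroup (Fin N) ℂ)) := (hs.pow 2).integrable_of_hasCompactSupport (HasCompactSupport.of_compactSpace _)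
  have hmean := integral_re_trace_one_sub_haar_SUN hN
  have hexp : (fun V : Matrix.specialUnitaryGroup (Fin N) ℂ => ((Matrix.trace (1 - (V : Matrix (Fin N) (Fin N) ℂ))).re - (N : ℝ)) ^ 2)
      = fun V => (Matrix.trace (1 - (V : Matrix (Fin N) (Fin N) ℂ))).re ^ 2 - 2 * (N : ℝ) * (Matrix.trace (1 - (V : Matrix (Fin N) (Fin N) ℂ))).re + (N : ℝ) ^ 2 := by
    funext V; ring
  have hi4 : Integrable (fun V : Matrix.specialUnitaryGroup (Fin N) ℂ => 2 * (N : ℝ) * (Matrix.trace (1 - (V : Matrix (Fin N) (Fin N) ℂ))).re)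
      (haarProbability (Matrix.specialUnitaryGroup (Fin N) ℂ)) := hi1.const_mul _
  have hi3 : Integrable (fun V : Matrix.specialUnitaryGroup (Fin N) ℂ =>
      (Matrix.trace (1 - (V : Matrix (Fin N) (Fin N) ℂ))).re ^ 2 - 2 * (N : ℝ) * (Matrix.trace (1 - (V : Matrix (Fin N) (Fin N) ℂ))).re)
      (haarProbability (Matrix.specialUnitaryGroup (Fin N) ℂ)) := hi2.sub hi4
  rw [hexp, integral_add hi3 (integrable_const _), integral_sub hi2 hi4, integral_const_mul, hmean, integral_const, probReal_univ, smul_eq_mul, one_mul]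
  ring

/-- **THE TILTED VARIANCE AT `β = 0` IS THE REFERENCE VARIANCE**: `W(0)∕Z(0) − (M(0)∕Z(0))² = ∫ (Re tr(1−V) − N)² dHaar` (`N ≥ 2`). [folklore] -/
theorem actionVariance_SUN_zero (hN : 2 ≤ N) :
    (∫ V, (Matrix.trace (1 - (V : Matrix (Fin N) (Fin N) ℂ))).re ^ 2 * Real.exp (-((0 : ℝ) * (Matrix.trace (1 - (V : Matrix (Fin N) (Fin N) ℂ))).re))
          ∂(haarProbability (Matrix.specialUnitaryGroup (Fin N) ℂ)))
        / (∫ V, Real.exp (-((0 : ℝ) * (Matrix.trace (1 - (V : Matrix (Fin N) (Fin N) ℂ))).re)) ∂(haarProbability (Matrix.specialUnitaryGroup (Fin N) ℂ)))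
      - ((∫ V, (Matrix.trace (1 - (V : Matrix (Fin N) (Fin N) ℂ))).re * Real.exp (-((0 : ℝ) * (Matrix.trace (1 - (V : Matrix (Fin N) (Fin N) ℂ))).re))
            ∂(haarProbability (Matrix.specialUnitaryGroup (Fin N) ℂ)))
          / ∫ V, Real.exp (-((0 : ℝ) * (Matrix.trace (1 - (V : Matrix (Fin N) (Fin N) ℂ))).re)) ∂(haarProbability (Matrix.specialUnitaryGroup (Fin N) ℂ))) ^ 2
      = ∫ V, ((Matrix.trace (1 - (V : Matrix (Fin N) (Fin N) ℂ))).re - (N : ℝ)) ^ 2 ∂(haarProbability (Matrix.specialUnitaryGroup (Fin N) ℂ)) := by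
  rw [meanAction_zero hN, secondMoment_SUN_zero, plaquetteMass_SUN_zero, div_one, integral_sq_sub_eq hN]

/-! ### §2 The mean action's slope at `β = 0` -/

/-- **`(⟨s⟩_β − N)∕β → −∫(s − N)² dHaar` AS `β → 0`, `β ≠ 0`** (`N ≥ 2`): V56's `⟨s⟩′(0) = −Var₀` as a slope limit, with §1's value of `Var₀`. [folklore] -/
theorem tendsto_meanAction_sub_div (hN : 2 ≤ N) :
    Tendsto (fun β : ℝ =>
        ((∫ V, (Matrix.trace (1 - (V : Matrix (Fin N) (Fin N) ℂ))).re * Real.exp (-(β * (Matrix.trace (1 - (V : Matrix (Fin N) (Fin N) ℂ))).re))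
              ∂(haarProbability (Matrix.specialUnitaryGroup (Fin N) ℂ)))
            / (∫ V, Real.exp (-(β * (Matrix.trace (1 - (V : Matrix (Fin N) (Fin N) ℂ))).re)) ∂(haarProbability (Matrix.specialUnitaryGroup (Fin N) ℂ)))
          - (N : ℝ)) / β)
      (𝓝[≠] 0) (𝓝 (-∫ V, ((Matrix.trace (1 - (V : Matrix (Fin N) (Fin N) ℂ))).re - (N : ℝ)) ^ 2 ∂(haarProbability (Matrix.specialUnitaryGroup (Fin N) ℂ)))) := by
  have h := (hasDerivAt_meanAction_SUN (N := N) 0).tendsto_slope_zero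
  rw [actionVariance_SUN_zero hN] at h
  refine h.congr' (eventually_nhdsWithin_of_forall fun β _ => ?_)
  simp only [zero_add, smul_eq_mul]
  rw [meanAction_zero hN]
  ring

/-! ### §3 The free energy to second order at strong coupling -/

/-- **THE STRONG-COUPLING EXPANSION TO SECOND ORDER, EVERY `N ≥ 2`**: `(−log Z_N(β) − N·β)∕β² → −½·∫(Re tr(1−V) − N)² dHaar` as `β → 0` (`β ≠ 0`), i.e.
`−log Z_N(β) = Nβ − ½·Var₀·β² + o(β²)` — l'Hôpital (`(−log Z_N)′ = ⟨s⟩`, V50) followed by §2. [folklore] -/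
theorem tendsto_freeEnergy_sub_linear_div_sq (hN : 2 ≤ N) :
    Tendsto (fun β : ℝ =>
        (-Real.log (∫ V, Real.exp (-(β * (Matrix.trace (1 - (V : Matrix (Fin N) (Fin N) ℂ))).re)) ∂(haarProbability (Matrix.specialUnitaryGroup (Fin N) ℂ)))
          - (N : ℝ) * β) / β ^ 2)
      (𝓝[≠] 0) (𝓝 (-(1 / 2) * ∫ V, ((Matrix.trace (1 - (V : Matrix (Fin N) (Fin N) ℂ))).re - (N : ℝ)) ^ 2 ∂(haarProbability (Matrix.specialUnitaryGroup (Fin N) ℂ)))) := by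
  have hF := fun b : ℝ => hasDerivAt_freeEnergy_SUN (N := N) b
  -- numerator and denominator derivatives
  have hf : ∀ b : ℝ, HasDerivAt (fun b : ℝ =>
      -Real.log (∫ V, Real.exp (-(b * (Matrix.trace (1 - (V : Matrix (Fin N) (Fin N) ℂ))).re)) ∂(haarProbability (Matrix.specialUnitaryGroup (Fin N) ℂ)))
        - (N : ℝ) * b)
      ((∫ V, (Matrix.trace (1 - (V : Matrix (Fin N) (Fin N) ℂ))).re * Real.exp (-(b * (Matrix.trace (1 - (V : Matrix (Fin N) (Fin N) ℂ))).re))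
            ∂(haarProbability (Matrix.specialUnitaryGroup (Fin N) ℂ)))
          / (∫ V, Real.exp (-(b * (Matrix.trace (1 - (V : Matrix (Fin N) (Fin N) ℂ))).re)) ∂(haarProbability (Matrix.specialUnitaryGroup (Fin N) ℂ)))
        - (N : ℝ)) b := by
    intro b
    have h1 : HasDerivAt (fun b : ℝ => (N : ℝ) * b) ((N : ℝ) * 1) b := (hasDerivAt_id b).const_mul (N : ℝ)
    rw [mul_one] at h1
    exact (hF b).sub h1
  have hg : ∀ b : ℝ, HasDerivAt (fun b : ℝ => b ^ 2) (2 * b) b := by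
    intro b
    simpa using hasDerivAt_pow 2 b
  refine HasDerivAt.lhopital_zero_nhdsNE (eventually_nhdsWithin_of_forall fun b _ => hf b) (eventually_nhdsWithin_of_forall fun b _ => hg b) ?_ ?_ ?_ ?_
  · exact eventually_nhdsWithin_of_forall fun b hb => mul_ne_zero two_ne_zero hb
  · -- numerator → 0: it is continuous and vanishes at 0
    have hc := (hf 0).continuousAt.tendsto
    rw [plaquetteMass_SUN_zero, Real.log_one, neg_zero, mul_zero, sub_zero] at hc
    exact hc.mono_left nhdsWithin_le_nhds
  · have hc : Tendsto (fun b : ℝ => b ^ 2) (𝓝 0) (𝓝 ((0 : ℝ) ^ 2)) := (continuous_pow 2).tendsto 0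
    rw [zero_pow two_ne_zero] at hc
    exact hc.mono_left nhdsWithin_le_nhds
  · -- quotient of derivatives: (⟨s⟩_b − N)/(2b) = ½ · (⟨s⟩_b − N)/b → ½ · (−Var₀)
    have h2 := (tendsto_meanAction_sub_div hN).const_mul (1 / 2 : ℝ)
    have h3 : Tendsto (fun β : ℝ => (1 / 2 : ℝ) *
        (((∫ V, (Matrix.trace (1 - (V : Matrix (Fin N) (Fin N) ℂ))).re * Real.exp (-(β * (Matrix.trace (1 - (V : Matrix (Fin N) (Fin N) ℂ))).re))
              ∂(haarProbability (Matrix.specialUnitaryGroup (Fin N) ℂ)))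
            / (∫ V, Real.exp (-(β * (Matrix.trace (1 - (V : Matrix (Fin N) (Fin N) ℂ))).re)) ∂(haarProbability (Matrix.specialUnitaryGroup (Fin N) ℂ)))
          - (N : ℝ)) / β))
        (𝓝[≠] 0) (𝓝 (-(1 / 2) * ∫ V, ((Matrix.trace (1 - (V : Matrix (Fin N) (Fin N) ℂ))).re - (N : ℝ)) ^ 2 ∂(haarProbability (Matrix.specialUnitaryGroup (Fin N) ℂ)))) := by
      convert h2 using 2
      ring
    refine h3.congr' (eventually_nhdsWithin_of_forall fun b _ => ?_)
    ring

/-- **`N ≥ 3`: `(−log Z_N(β) − Nβ)∕β² → −1∕4`** (`Var₀ = ½` by V51's `integral_sq_traceDeficit_sub_mean` — the strong-coupling curvature is `N`-independent from `N = 3` on). [folklore] -/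
theorem tendsto_freeEnergy_sub_linear_div_sq_of_three_le (hN : 3 ≤ N) :
    Tendsto (fun β : ℝ =>
        (-Real.log (∫ V, Real.exp (-(β * (Matrix.trace (1 - (V : Matrix (Fin N) (Fin N) ℂ))).re)) ∂(haarProbability (Matrix.specialUnitaryGroup (Fin N) ℂ)))
          - (N : ℝ) * β) / β ^ 2)
      (𝓝[≠] 0) (𝓝 (-(1 / 4))) := by
  have h := tendsto_freeEnergy_sub_linear_div_sq (N := N) (le_trans (by norm_num) hN)
  rw [integral_sq_traceDeficit_sub_mean hN, show (-(1 / 2) : ℝ) * (1 / 2) = -(1 / 4) by norm_num] at h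
  exact h

/-- **`SU(2)`: `(−log Z(β) − 2β)∕β² → −1∕2`** (`Var₀ = 1` by V51's `integral_sq_traceDeficit_sub_mean_SU2`). [folklore] -/
theorem tendsto_freeEnergy_sub_linear_div_sq_SU2 :
    Tendsto (fun β : ℝ =>
        (-Real.log (∫ V, Real.exp (-(β * (Matrix.trace (1 - (V : Matrix (Fin 2) (Fin 2) ℂ))).re)) ∂(haarProbability (Matrix.specialUnitaryGroup (Fin 2) ℂ)))
          - (2 : ℝ) * β) / β ^ 2)
      (𝓝[≠] 0) (𝓝 (-(1 / 2))) := by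
  have h := tendsto_freeEnergy_sub_linear_div_sq (N := 2) le_rfl
  simp only [Nat.cast_ofNat] at h
  rw [integral_sq_traceDeficit_sub_mean_SU2, mul_one] at h
  exact h

end Summit.QuantumFields.BalabanUV.T4Continuum.NE7b.CompactFibreFreeEnergySUNStrongCoupling

end
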